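import Summits.QuantumFields.YangMills.Theorems.SourcedPressureJensenSourcedPressureDecouplingDefs
import Summits.QuantumFields.YangMills.Theorems.SourcedPressureJensenSourcedPressureDecouplingTorusMeanBound
import HarnessLib

/-!
# Route `SourcedPressureJensen`, crux `SourcedPressureDecoupling` (KS2″, stmt-QuantumFields-24296), line «ENTROPIC-SEAM»:
# the registered stub `stub_window` — the centring window `|m_T| ≤ W`, PROVED

`stub_window` of the planner's birth skeleton (`bc/line2/SourcedPressureDecoupling_birth_w.lean`; object `mT` in
`…SourcedPressureDecouplingDefs`): `∀ G` compact simple, `∀ r`, `∃ W β₁, ∀ β ≥ β₁, ∀ᶠ L, |mT r β L| ≤ W` — an alias of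
`SourcedPressureJensen.abs_torusMean_plaqCost_le` (the proved crux `FreeEnergyRate` + the convexity transfer `budgetRate_torus_plane`).

Everything is proved; no definition, no named fact.  RECORD-label rung support (route target `XiPow` = an upper bound on the lattice gap);
the Yang–Mills mass gap is NOT proved by anything here. [folklore]
-/

set_option autoImplicit false

noncomputable section

namespace Summit.QuantumFields.YangMills.Cruxes.SourcedPressureDecoupling.EntropicSeam

open Filter
open Literature.MathematicalPhysics.QuantumFieldTheory Literature.MathematicalPhysics.QuantumLattice
  Summit.QuantumFields.YangMills.Theorems.WeakCouplingRates

/-- **`stub_window`** (registered stub of the KS2″ line «ENTROPIC-SEAM»; crude equipartition window on the torus): for every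
compact simple `G` and lattice representation `r` there are `W, β₁` with `|m_T| = |β·E_{β,L+1}[c₁₂]| ≤ W` for `β ≥ β₁`, eventually in
the torus size — the proved crux `FreeEnergyRate` plus the convexity transfer to finite tori
(`Summit.QuantumFields.YangMills.Theorems.SourcedPressureJensen.abs_torusMean_plaqCost_le`). [folklore] -/
theorem stub_window_explicit :
    ∀ (G : Type) [Group G] [TopologicalSpace G] [IsTopologicalGroup G] [CompactSpace G], IsCompactSimpleLieGroup G →
      letI : MeasurableSpace G := borel G
      haveI : BorelSpace G := ⟨rfl⟩
      ∀ r : LatticeRep G, ∃ W β₁ : ℝ, ∀ β : ℝ, β₁ ≤ β → ∀ᶠ L : ℕ in Filter.atTop, |mT r β L| ≤ W := by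
  intro G _ _ _ _ hG
  letI : MeasurableSpace G := borel G
  haveI : BorelSpace G := ⟨rfl⟩
  intro r
  obtain ⟨W, β₂, h⟩ := Summit.QuantumFields.YangMills.Theorems.SourcedPressureJensen.abs_torusMean_plaqCost_le G hG r
  refine ⟨W, β₂, fun β hβ => ?_⟩
  filter_upwards [h β hβ] with L hL
  unfold mT
  exact hL

set_option linter.style.nameCheck false in
/-- STUB (crude equipartition window; M).  From the PROVED `FreeEnergyRate` (stmt-QuantumFields-22402) and convexity of the torus pressure
in `β` (Griffiths' lemma on difference quotients at `β(1 ± β^(−κ/2))`): `β·E_T[c] = dim 𝔤/4 + O(β^(−κ/2))` eventually in `L`.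
Registered statement of `stub_window` (name-keyed alias, device of `Cruxes/*/Lines/birth.lean`: the skeleton audit admits a
hypothesis of the composition only if its head constant is named like a declared stub). -/
abbrev __Registered.stub_window : Prop :=
  ∀ (G : Type) [Group G] [TopologicalSpace G] [IsTopologicalGroup G] [CompactSpace G], IsCompactSimpleLieGroup G → letI : MeasurableSpace G := borel G; haveI : BorelSpace G := ⟨rfl⟩; ∀ r : LatticeRep G, ∃ W β₁ : ℝ, ∀ β : ℝ, β₁ ≤ β → ∀ᶠ L : ℕ in Filter.atTop, |mT r β L| ≤ W

/-- **`stub_window`** in the REGISTERED form of the KS2″ skeleton (statement `__Registered.stub_window`). [folklore] -/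
theorem stub_window : __Registered.stub_window := stub_window_explicit

end Summit.QuantumFields.YangMills.Cruxes.SourcedPressureDecoupling.EntropicSeam

end
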